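import Summits.QuantumFields.YangMills.Theorems.BalabanUVNodesN26BetaCont
import Summits.QuantumFields.YangMills.Theorems.BalabanUVNodesN26AtRecord8
import Summits.QuantumFields.YangMills.Theorems.BalabanUVNodesClustersCore
import Literature.MathematicalPhysics.QuantumFieldTheory.Balaban1983to89.Node00.Record8Inhabited

/-!
# DAG node N26 — the detail route's literal `YMDAG.UVSplit.N26_B4lit Rec` (module `BalabanUVNodesClustersCore`, p416552; an aside in no
# join) BY NAME: for ANY record predicate from the rows-(D4) ∧ B4 residue, AT NODE 00's Stage-8 record predicate `IsRecordOfRecord₈C` from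
# the (D4) socket inputs over EVERY admissible θ — and the ZEROCHART honesty label (chair R445 (A), ref-D control rule v0.33)

Cell `pub-ymgap`, YM-PLAN Track A (HUMAN RULING D-0062), seat `pub-ymgap-dag-n26-a` (gen 3; -a = KNIT-BY-NAME); seventh companion of
`BalabanUVNodesN26BetaCont{,Record,Merged,FiniteRep,WallEnd}` ∕ `BalabanUVNodesN26AtRecord8`.  STATUS OF RECORD: N26 = binder B4
«β-continuity» is DEPENDENT on row (D4) and VACATED in the discharge form of record (closes WITH B3 = N25, NODE O); instance 0∕1.

WHAT IS HERE (compositions of tree theorems BY NAME; no definition, no estimate, 0 `sorry`):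
* §1 `n26_B4lit_of_atSlopeCont` — `N26_B4lit Rec` for ANY `Rec : RecordPred N` from the packaged rows-(D4) ∧ B4 residue
  `Gaps.BetaContFromD4Chain.AtSlopeCont` with `0 < γ₀` at every record pair (gen 0's `BalabanUVNodesN26.n26_at_record`).
* §2 `n26_B4lit_rec8C` — `N26_B4lit (fun F D w => Node00.IsRecordOfRecord₈C F N D w)`: the ∀-FORM over every four-torus family, every
  record pair and EVERY admissible Stage-8 parameter θ realising the datum, from the (D4) socket inputs for θ's OWN merged term family
  (gen 2's `BalabanUVNodesN26AtRecord8.n26_of_isRecordOfRecord₈C`): located inputs = one-loop kernels `P0` pinned on `beta0OfMerged … θ.v₀`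
  with (5.10), leaf kernels `A1` with [II]-(2.38)∕(190) records `PolLeavesTFac190H`, the localized representation `hrep` of the merged
  limit kernel, the side conditions `CondsL ∕ R22gen ∕ Valid ∕ SignsL`, and the history-continuity clause (C-pt) — all DECLARED.
* §3 ZEROCHART HONESTY LABEL (chair R445 (A); ref-D READ-TRIGGER B4-ZEROCHART, pub-ymgap INBOX l.10364; director-ym LINE №31).
  `n26lit_of_βfun_eq_zeroHBeta` — at ANY datum whose β-family is the zero family N26's literal holds with every positive radius (a
  constant is continuous); `exists_rec8C_and_n26lit_contentFree` — hence the ∃-FORM «some ₈C record satisfies N26» is a ONE-LINE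
  theorem (n23-b's `Node00.Record8Inhabited.exists_isRecordOfRecord₈C_flatBeta`: the zero chart `θ.ρ8 = 0` gives `βfun = zeroHBeta`) and
  is NEVER a discharge shape (VACUOUS-A1-by-junk); the countable shape is §2's ∀-form, whose content is carried by the non-degenerate
  charts.  (The zero chart read through ALL β-side binders B3 ∕ B4 ∕ B6 is dag-n28-a's `BalabanUVNodesN28ZeroChart`, filed separately;
  not restated here.)
HONEST FRAMING: bookkeeping by name; nothing of Bałaban's asserted; N26 NOT discharged (instance 0∕1, closes WITH N25); one finite
four-torus programme at fixed ε per run — NOT the continuum limit, NOT ℝ⁴, NOT OS, NOT a mass gap, NOT Clay.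
[Balaban1987RG1] = T. Bałaban, Commun. Math. Phys. **109** (1987) 249–301: (1.20)–(1.22) p. 264 (β from the vacuum polarization; «It is
a smooth function defined on the interval [0, γ], (or analytic)»); [Balaban1988RG2Cluster] = Commun. Math. Phys. **116** (1988) 1–22: Lemma 3 (2.38) p. 20.
-/

noncomputable section

open scoped Matrix.Norms.L2Operator

namespace Summit.QuantumFields.YangMills.Theorems.BalabanUVNodesN26B4lit

open Literature.MathematicalPhysics.QuantumFieldTheory.Balaban1983to89
open Literature.MathematicalPhysics.QuantumFieldTheory.Balaban1983to89.FlowStep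
open Literature.MathematicalPhysics.QuantumFieldTheory.Balaban1983to89.DagBinding (WorldP)
open Literature.MathematicalPhysics.QuantumFieldTheory.Balaban1983to89.T4Continuum (T4Family FiniteEpsData)
open Literature.MathematicalPhysics.QuantumFieldTheory.Balaban1983to89.T4FiniteEpsInhabited (zeroHBeta)
open Literature.MathematicalPhysics.QuantumFieldTheory.Balaban1983to89.Node00
open Literature.MathematicalPhysics.QuantumFieldTheory.Balaban1983to89.B13ScaleTransfer (Pt)
open Literature.MathematicalPhysics.QuantumFieldTheory.Balaban1983to89.Beta.RemainderChainLattice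
open Literature.MathematicalPhysics.QuantumFieldTheory.Balaban1983to89.Beta.RemainderLimitTorus (LDom limKernel)
open Literature.MathematicalPhysics.QuantumFieldTheory.Balaban1983to89.Beta.RemainderDecay190
open Literature.MathematicalPhysics.QuantumFieldTheory.Balaban1983to89.Beta.RemainderLocalityHolo (PolLeavesTFac190H)
open Summit.QuantumFields.BalabanUV.Gaps.BetaContFromD4Chain
open Filter Topology

/-! ## §1 `N26_B4lit Rec` for ANY record predicate, from the rows-(D4) ∧ B4 residue -/

/-- **`N26_B4lit Rec` for ANY record predicate** from the packaged rows-(D4) ∧ B4 residue `AtSlopeCont Sβ γ₀ s` with `0 < γ₀` at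
every record pair (gen 0's `BalabanUVNodesN26.n26_at_record` BY NAME; the supply's `Datum F N` is `FiniteEpsData F (SU N)` by `abbrev`).
Declared hypothesis; instance 0∕1. [cite: Balaban1987RG1, (1.20)-(1.22) p.264; Balaban1988RG2Cluster, Lemma 3 (2.38) p.20] -/
theorem n26_B4lit_of_atSlopeCont {N : ℕ} [NeZero N] (Rec : YMDAG.UVSplit.RecordPred N)
    (hD4 : ∀ (F : T4Family) (D : FiniteEpsData F (Matrix.specialUnitaryGroup (Fin N) ℂ)) (w : WorldP), Rec F D w →
      ∃ (Sβ : B12Beta.OneLoopSplit D.βfun) (γ₀ s : ℝ), 0 < γ₀ ∧ AtSlopeCont Sβ γ₀ s) :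
    YMDAG.UVSplit.N26_B4lit Rec :=
  BalabanUVNodesN26.n26_at_record Rec hD4

/-! ## §2 `N26_B4lit` AT NODE 00's Stage-8 record predicate, ∀-form over every admissible θ -/

/-- **`N26_B4lit` AT NODE 00's STAGE-8 RECORD PREDICATE** `fun F D w => IsRecordOfRecord₈C F N D w`, from the (D4) socket inputs for the
record's OWN merged term family `mergedTermFamilyMat F N (chi7 F N θ) θ.εbg` (chart `θ.ρ8 ∕ θ.bV`, one-loop object `beta0OfMerged … θ.v₀`),
asked of every family `F`, every record pair and EVERY admissible θ realising the datum (gen 2's `n26_of_isRecordOfRecord₈C` BY NAME; the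
box is the world's window, `0 < w.γ ≤ θ.γ` read off the predicate).  ∀-form (chair R445 (A) (a2)); its content is carried by the
non-degenerate charts (§3).  Instance 0∕1; N26 NOT discharged.
[cite: Balaban1987RG1, (1.7) p.261 and (1.20)-(1.22) p.264; Balaban1988RG2Cluster, Lemma 3 (2.38) p.20] -/
theorem n26_B4lit_rec8C {N : ℕ} [NeZero N]
    (hin : ∀ (F : T4Family) (D : FiniteEpsData F (Matrix.specialUnitaryGroup (Fin N) ℂ)) (w : WorldP) (θ : Stage8Params F N),
      θ.Admissible → D = datumOfRecord₅ F N (θ.toStage5 F N) → w.γ ≤ θ.γ →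
      letI := θ.instVβ₁; letI := θ.instVβ₂; letI := θ.instιβ
      ∃ (M : ℕ) (_ : NeZero M) (c : B13.Consts) (ℓ α₂ : ℝ) (q : Consts190) (P0 : ℕ → Pt 4 → ℝ)
        (A1 : (k : ℕ) → (Fin (k + 1) → ℝ) → LDom 4 → Pt 4 → ℝ),
        (∀ k, beta0OfMerged (betaMerged F (mergedTermFamilyMat F N (chi7 F N θ) θ.εbg) θ.ρ8 θ.bV) θ.v₀ k =
          B12Beta.secondMoment (fun _ _ => P0 k) 0 1) ∧
        (∀ k, ∃ C δ₁ : ℝ, 0 < δ₁ ∧ B12Sec2to5.Decay510 (P0 k) C δ₁) ∧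
        (∀ k (p : Fin (k + 1) → ℝ), p ∈ Box w.γ k → ∀ z : Pt 4,
          polLimit F (k + 1) (fun K => mergedTermFamilyMat F N (chi7 F N θ) θ.εbg k p K) θ.ρ8 θ.bV 0 1 z =
            P0 k z + limKernel (A1 k p) z) ∧
        (∀ k (p : Fin (k + 1) → ℝ), p ∈ Box w.γ k → Nonempty (PolLeavesTFac190H 4 M (A1 k p) c ℓ α₂ q)) ∧
        CondsL 4 c ℓ ∧ c.R22gen ℓ ∧ q.Valid c.δ₀ ∧ SignsL c α₂ q.B₃ ∧
        (∀ k (z : Pt 4), ContinuousOn (fun p : Fin (k + 1) → ℝ =>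
          polLimit F (k + 1) (fun K => mergedTermFamilyMat F N (chi7 F N θ) θ.εbg k p K) θ.ρ8 θ.bV 0 1 z) (Box w.γ k))) :
    YMDAG.UVSplit.N26_B4lit (fun F D w => IsRecordOfRecord₈C F N D w) :=
  fun F D w h => BalabanUVNodesN26AtRecord8.n26_of_isRecordOfRecord₈C F N h (hin F D w)

/-! ## §3 ZEROCHART honesty label (chair R445 (A); ref-D control rule v0.33): the ∃-form over `IsRecordOfRecord₈C` is content-free -/

/-- N26's literal at ANY datum whose β-family is the ZERO family `T4FiniteEpsInhabited.zeroHBeta`, with any positive witness radius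
(a constant is continuous on every box). [cite: Balaban1987RG1, (1.22) p.264 (bookkeeping at β ≡ 0)] -/
theorem n26lit_of_βfun_eq_zeroHBeta {F : T4Family} {G : Type*} [GaugeGroup G] [MeasurableSpace G] [HaarData G]
    (D : FiniteEpsData F G) (h : D.βfun = zeroHBeta) : ∃ γc : ℝ, 0 < γc ∧ BetaContH γc D.βfun :=
  ⟨1, one_pos, fun k => by rw [h]; exact continuousOn_const⟩

/-- **The ∃-FORM over the ₈C record predicate is a one-line theorem, hence NEVER a discharge shape for N26** (VACUOUS-A1-by-junk,
chair R445 (A) (a1)): some Stage-8 record — the zero-chart inhabitant of n23-b's `Node00.Record8Inhabited.exists_isRecordOfRecord₈C_flatBeta`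
— has the zero β-family, and N26's literal there.  Recorded by the N26 seat so that no seat files this shape as a claim; the countable
shape is §2's ∀-form over every admissible θ. [cite: Balaban1987RG1, (1.22) p.264 (bookkeeping at β ≡ 0)] -/
theorem exists_rec8C_and_n26lit_contentFree (F : T4Family) (N : ℕ) [NeZero N] :
    ∃ (D : FiniteEpsData F (Matrix.specialUnitaryGroup (Fin N) ℂ)) (w : WorldP),
      IsRecordOfRecord₈C F N D w ∧ ∃ γc : ℝ, 0 < γc ∧ BetaContH γc D.βfun := by
  obtain ⟨D, w, hrec, hβ, -⟩ := Record8Inhabited.exists_isRecordOfRecord₈C_flatBeta (F := F) (N := N)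
  exact ⟨D, w, hrec, n26lit_of_βfun_eq_zeroHBeta D hβ⟩

end Summit.QuantumFields.YangMills.Theorems.BalabanUVNodesN26B4lit

end
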